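/-
Copyright (c) 2026 the pub-hodgecm-mathlib formalisation cell (harness21).  Prover seat hodgecm-mathlib-LH10-p01 (g3): line LH4 (dyadic pay-down of `stub_N6nsDyadic`),
organ (D-SH), WILD road, brick ‹U-FIN-wild› (W-b) (LH4-plan (g3) DEALER WORD #12); 2026-09-02.
-/
import Literature.NumberTheory.Automorphic.UnitaryGroupInertPlaceHyperbolicBasis   -- ★ `galAdicCompletionMap_galAdicCompletionMap_of_smul_eq` (σ_w is an involution); brings `galAdicCompletionMap`, `PlacesOver`, ★ `Liu2021.exists_galAdicCompletionMap_ne`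
import Literature.NumberTheory.Automorphic.SubgroupIndexDevissage                 -- ★ `relIndex_leAddSubgroup_exp_ne_zero` (the valuation balls are commensurable)
import Literature.NumberTheory.Automorphic.AdicCompletionCompact                  -- ★ `finite_residueField_adicCompletion`
import Literature.NumberTheory.Automorphic.Liu2021.FinAdelicCheckSurjective      -- ★ `Liu2021.exists_galAdicCompletionMap_ne` (σ_w ≠ id)
import Literature.NumberTheory.LocalFields.CompleteValuedSquareRootNearOne   -- ★ p850199 (W-a) (LH5-p03 (g2)): `exists_mul_self_eq_of_valued_sub_one_lt_four_adicCompletion` (ED. 2)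
import HarnessLib

/-!
# The norm classes `F^× ∕ N(E^×)` of a quadratic extension of non-archimedean local fields are FINITE — at EVERY residue characteristic, from «deep one-units are squares»
(Serre, *Local Fields*, Ch. V §2–§3; Neukirch ANT II (5.7); here: no class field theory, no parity hypothesis on the residue characteristic)

Topic `NumberTheory/LocalFields`; namespace `Literature.NumberTheory.LocalFields`.  THEOREMS ONLY (no definition, no instance, no notation, no named fact, no `sorry`);
kernel lane `--supports stmt-HodgeConjecture-24833`.  Cell `pub/hodgecm-mathlib` (D-0151), crux H413 = `stmt-HodgeConjecture-24833`; half A line LH4, the DYADIC pay-down of the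
closer row `stub_N6nsDyadic` (leaf `Cruxes/H413/Lines/F0_P3c_DyadicPaydown.lean` ED. 1, LH4-plan (g3)), organ (D-SH), WILD (ramified dyadic) road, brick ‹U-FIN-wild› = «the unipotent
conjugacy classes of `U(Φ₃)(L⁺_v)` are finitely many at EVERY non-split place» (census `F0/P3c/LH10/LH10-p01/g3/UFIN-WILD-CENSUS.md` b7762a7bdb1a99be): (W-a) «deep one-units are
squares» (LH5-p03 (g2), CM-free, carried here as the HYPOTHESIS `hsq` BY STATEMENT until ★), (W-b) THIS FILE, (W-c) the class census `UnitaryThreeUnipotentClassesFiniteAllCM`.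

THE MATHEMATICS.  `K` a valued field (`Valued K ℤᵐ⁰`), `σ` an isometric involution of `K` (the local conjugation `σ_w` of `E = L_w` over `F = Fix(σ) = L⁺_v`), `N z = z·σz`.
(i) ROOT UNIQUENESS NEAR `1`: if `r² = r′²` and `v(r − 1), v(r′ − 1) < v 2` then `r = r′` (the other root `−r` has `v(−r − 1) = v((r − 1) + 2) = v 2`).  (ii) Hence a square root
`r` of a σ-FIXED `s` with `v(r − 1) < v 2` is σ-FIXED (`σr` is a competing root at the same distance), so `s = r·σr ∈ N(E^×)`: under the hypothesis
(W-a) `hsq : ∀ s, v(s − 1) < v 4 → ∃ r, r² = s ∧ v(r − 1) < v 2` (strong Hensel ∕ Newton for `X² − s`, [Serre1979 Ch. II §3], true in every complete `K`), EVERY σ-FIXED `s` WITH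
`v(s − 1) < v 4` IS A NORM.  (iii) The ball `{v ≤ v(4ϖ)}` has finite index in `𝒪` (★ `relIndex_leAddSubgroup_exp_ne_zero`, finite residue field), so finitely many σ-fixed units
`t ∈ T` represent the σ-fixed units modulo `{s : v(s − 1) < v 4}`, hence modulo norms: `U_F = ⋃_{t ∈ T} t·N(E^×)`.  (iv) Valuations: `N(ϖ_E)` is fixed of value `exp(−2)`, so every
fixed `g ≠ 0` is `N(ϖ_E)^{−j}·g′` with `v g′ ∈ {1, exp(−1)}`; the odd case is absorbed by ONE fixed element of value `exp(−1)` when such exists (inert places) and is void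
otherwise.  Hence `F^× = ⋃_{t ∈ T′} t·N(E^×)` with `T′` finite, and — multiplying by one skew `ξ₀ ≠ 0` — the non-zero SKEW elements (the transvection parameters of `U(3)`,
[Rogawski1990 §3.9]) fall into finitely many `N(E^×)`-classes.  The COUNT (`[F^× : N E^×] = 2`, local class field theory) is NOT claimed and not needed by ‹U-FIN›.

* §1 generic (`K`, `σ`): `eq_of_mul_self_eq_of_valued_sub_one_lt_two`, `map_eq_self_of_mul_self_eq`, `exists_fixed_norm_eq_of_valued_sub_one_lt_four`,
  `exists_finset_fixed_units_mod_norms`, `exists_finset_skew_mod_norms_of_involution`.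
* §2 CM dress at a non-split place `w ∣ v` of `L ∕ L⁺` (`K := L_w`, `σ := σ_w`): **`exists_finset_skew_mod_norms`** (hypothesis `hsq` = (W-a) at `L_w`, by statement).
* §3 (ED. 2) **`exists_finset_skew_mod_norms'`** — the HYPOTHESIS-FREE twin: `hsq` discharged by ★ p850199 `exists_mul_self_eq_of_valued_sub_one_lt_four_adicCompletion L w.1`.
HONEST LABEL: HC_CM is proved only modulo the 7 printed citations (2 remaining: hLiu418 = stmt-HodgeConjecture-24832, h413 = stmt-HodgeConjecture-24833) until rung 0 closes;
count-neutral brick of the in-house road of the PRINT organ (D-SH); nothing printed is discharged here.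

## References
* [Serre1979] J.-P. Serre, *Local Fields*, GTM 67 (1979): Ch. II §3 (one-units, Hensel), Ch. V §2 Prop. 3, §3 Cor. 2 (norm groups of quadratic extensions).
* [NeukirchANT1999] J. Neukirch, *Algebraic Number Theory* (1999), Ch. II (5.7)–(5.8) (structure of `U_K`, finiteness of power classes).
* [Rogawski1990] J. D. Rogawski, *Automorphic Representations of Unitary Groups in Three Variables*, Ann. of Math. Stud. 123 (1990), §3.9 Prop. 3.9.1 p. 32.
-/

set_option autoImplicit false

noncomputable section

open scoped WithZero Valued
open NumberField IsDedekindDomain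

namespace Literature.NumberTheory.LocalFields

/-! ## §1 Generic valued field with an isometric involution -/

section Generic

variable {K : Type*} [Field K] [Valued K ℤᵐ⁰] (σ : K →+* K)

omit σ in
/-- **Root uniqueness near `1`**: two square roots `r, r′` of the same element with `v(r − 1) < v 2` and `v(r′ − 1) < v 2` coincide (the competitor `−r` sits at distance
exactly `v 2` from `1`). [cite: Serre1979, Ch. II §3] -/
theorem eq_of_mul_self_eq_of_valued_sub_one_lt_two {r r' : K} (h : r * r = r' * r') (hr : Valued.v (r - 1) < Valued.v (2 : K))
    (hr' : Valued.v (r' - 1) < Valued.v (2 : K)) : r = r' := by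
  have hfac : (r' - r) * (r' + r) = 0 := by linear_combination h.symm
  rcases mul_eq_zero.1 hfac with h0 | h0
  · exact (sub_eq_zero.1 h0).symm
  · exfalso
    have hr'' : r' = -r := eq_neg_of_add_eq_zero_left h0
    have hkey : Valued.v (r' - 1) = Valued.v (2 : K) := by
      rw [hr'', show -r - 1 = -((r - 1) + 2) by ring, Valuation.map_neg, Valuation.map_add_eq_of_lt_right _ hr]
    exact (lt_irrefl _) (hkey ▸ hr')

/-- **A square root near `1` of a σ-fixed element is σ-fixed** (`σ` isometric): `σr` is a root of the same equation at the same distance from `1`.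
[cite: Serre1979, Ch. V §2] -/
theorem map_eq_self_of_mul_self_eq (hσv : ∀ x : K, Valued.v (σ x) = Valued.v x) {s r : K} (hσs : σ s = s) (hrs : r * r = s)
    (hr : Valued.v (r - 1) < Valued.v (2 : K)) : σ r = r := by
  refine eq_of_mul_self_eq_of_valued_sub_one_lt_two (by rw [← map_mul, hrs, hσs]) ?_ hr
  rw [show σ r - 1 = σ (r - 1) by rw [map_sub, map_one], hσv]
  exact hr

/-- **Deep σ-fixed one-units are norms**: under (W-a) `hsq` («`v(s − 1) < v 4 ⇒ s = r²` with `v(r − 1) < v 2`»), every σ-fixed `s` with `v(s − 1) < v 4` is `r·σr` with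
`σr = r` — every residue characteristic, every ramification. [cite: Serre1979, Ch. V §2 Prop. 3, Ch. II §3] -/
theorem exists_fixed_norm_eq_of_valued_sub_one_lt_four (hσv : ∀ x : K, Valued.v (σ x) = Valued.v x)
    (hsq : ∀ s : K, Valued.v (s - 1) < Valued.v (4 : K) → ∃ r : K, r * r = s ∧ Valued.v (r - 1) < Valued.v (2 : K))
    {s : K} (hσs : σ s = s) (hs : Valued.v (s - 1) < Valued.v (4 : K)) : ∃ r : K, σ r = r ∧ r * σ r = s := by
  obtain ⟨r, hrs, hr⟩ := hsq s hs
  have hσr := map_eq_self_of_mul_self_eq σ hσv hσs hrs hr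
  exact ⟨r, hσr, by rw [hσr, hrs]⟩

omit [Valued K ℤᵐ⁰] σ in
/-- Finitely many representatives, WITH A PRESCRIBED PROPERTY, of the classes of `B` modulo a subgroup `A` of finite relative index that meet that property (pure group theory).
[cite: Serre1979, Ch. II §3] -/
private theorem exists_finset_rep {M : Type*} [AddCommGroup M] (A B : AddSubgroup M) (hN : A.relIndex B ≠ 0) (P : M → Prop) :
    ∃ T : Finset M, (∀ t ∈ T, t ∈ B ∧ P t) ∧ ∀ b ∈ B, P b → ∃ t ∈ T, b - t ∈ A := by
  classical
  haveI : (A.addSubgroupOf B).FiniteIndex := ⟨hN⟩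
  haveI : Finite (↥B ⧸ A.addSubgroupOf B) := AddSubgroup.finite_quotient_of_finiteIndex
  letI : Fintype (↥B ⧸ A.addSubgroupOf B) := Fintype.ofFinite _
  let f : (↥B ⧸ A.addSubgroupOf B) → M := fun q =>
    if h : ∃ b : ↥B, P (b : M) ∧ (QuotientAddGroup.mk b : ↥B ⧸ A.addSubgroupOf B) = q then ((h.choose : ↥B) : M) else 0
  refine ⟨(Finset.univ.image f).filter (fun t => t ∈ B ∧ P t), fun t ht => (Finset.mem_filter.1 ht).2, fun b hb hPb => ?_⟩
  have hex : ∃ b' : ↥B, P (b' : M) ∧ (QuotientAddGroup.mk b' : ↥B ⧸ A.addSubgroupOf B) = QuotientAddGroup.mk ⟨b, hb⟩ := ⟨⟨b, hb⟩, hPb, rfl⟩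
  have hfq : f (QuotientAddGroup.mk ⟨b, hb⟩) = ((hex.choose : ↥B) : M) := dif_pos hex
  refine ⟨f (QuotientAddGroup.mk ⟨b, hb⟩), Finset.mem_filter.2 ⟨Finset.mem_image_of_mem _ (Finset.mem_univ _), ?_, ?_⟩, ?_⟩
  · rw [hfq]; exact SetLike.coe_mem _
  · rw [hfq]; exact hex.choose_spec.1
  · rw [hfq]
    have hmk := hex.choose_spec.2
    rw [QuotientAddGroup.eq] at hmk
    have hmem : (-(hex.choose : M) + b) ∈ A := AddSubgroup.mem_addSubgroupOf.1 hmk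
    rwa [neg_add_eq_sub] at hmem

/-- **Finitely many σ-fixed units represent the σ-fixed units modulo norms** (`σ` isometric, (W-a) `hsq`, a uniformiser `ϖ`, finite residue field, `4 ≠ 0`): there is a finite
set `T` of σ-fixed units with `u ∈ ⋃_{t ∈ T} t·N(K^×)` for every σ-fixed unit `u` — representatives of the fixed units modulo the ball `{v(· − 1) ≤ v(4ϖ)}` (★
`relIndex_leAddSubgroup_exp_ne_zero`), each class collapsed by `exists_fixed_norm_eq_of_valued_sub_one_lt_four`. [cite: Serre1979, Ch. V §2 Prop. 3] [cite: NeukirchANT1999, Ch. II (5.7)] -/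
theorem exists_finset_fixed_units_mod_norms (hσv : ∀ x : K, Valued.v (σ x) = Valued.v x)
    (hsq : ∀ s : K, Valued.v (s - 1) < Valued.v (4 : K) → ∃ r : K, r * r = s ∧ Valued.v (r - 1) < Valued.v (2 : K))
    {ϖ : K} (hϖ : Valued.v ϖ = WithZero.exp (-1 : ℤ)) [Finite 𝓀[K]] (h4 : (4 : K) ≠ 0) :
    ∃ T : Finset K, (∀ t ∈ T, σ t = t ∧ Valued.v t = 1) ∧
      ∀ u : K, σ u = u → Valued.v u = 1 → ∃ t ∈ T, ∃ z : K, z ≠ 0 ∧ u = t * (z * σ z) := by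
  -- `v 4 = exp n₄`
  obtain ⟨n₄, hn₄⟩ : ∃ n : ℤ, Valued.v (4 : K) = WithZero.exp n := by
    have h0 : Valued.v (4 : K) ≠ 0 := (Valuation.ne_zero_iff _).2 h4
    obtain ⟨e, he⟩ := WithZero.ne_zero_iff_exists.1 h0
    exact ⟨Multiplicative.toAdd e, by rw [← he]; rfl⟩
  -- representatives of `𝒪 = {v ≤ exp 0}` modulo `{v ≤ exp (n₄ − 1)}` among the σ-fixed units
  obtain ⟨T, hT, hrep⟩ := exists_finset_rep ((Valued.v : Valuation K ℤᵐ⁰).leAddSubgroup (WithZero.exp (n₄ - 1)))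
    ((Valued.v : Valuation K ℤᵐ⁰).leAddSubgroup (WithZero.exp (0 : ℤ)))
    (Literature.NumberTheory.Automorphic.relIndex_leAddSubgroup_exp_ne_zero hϖ 0 (n₄ - 1)) (fun t => σ t = t ∧ Valued.v t = 1)
  refine ⟨T, fun t ht => (hT t ht).2, fun u hσu hvu => ?_⟩
  have huB : u ∈ (Valued.v : Valuation K ℤᵐ⁰).leAddSubgroup (WithZero.exp (0 : ℤ)) := by
    rw [Valuation.mem_leAddSubgroup_iff, WithZero.exp_zero, hvu]
  obtain ⟨t, htT, hut⟩ := hrep u huB ⟨hσu, hvu⟩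
  obtain ⟨-, hσt, hvt⟩ := hT t htT
  rw [Valuation.mem_leAddSubgroup_iff] at hut
  have ht0 : t ≠ 0 := (Valuation.ne_zero_iff _).1 (by rw [hvt]; exact one_ne_zero)
  -- `s := u · t⁻¹` is fixed with `v(s − 1) < v 4`
  have hσs : σ (u * t⁻¹) = u * t⁻¹ := by rw [map_mul, map_inv₀, hσu, hσt]
  have hs : Valued.v (u * t⁻¹ - 1) < Valued.v (4 : K) := by
    rw [show u * t⁻¹ - 1 = (u - t) * t⁻¹ by field_simp, Valuation.map_mul, map_inv₀, hvt, inv_one, mul_one, hn₄]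
    exact lt_of_le_of_lt hut (WithZero.exp_lt_exp.2 (by omega))
  obtain ⟨r, hσr, hrs⟩ := exists_fixed_norm_eq_of_valued_sub_one_lt_four σ hσv hsq hσs hs
  refine ⟨t, htT, r, ?_, ?_⟩
  · rintro rfl
    rw [zero_mul] at hrs
    exact (mul_ne_zero ((Valuation.ne_zero_iff _).1 (by rw [hvu]; exact one_ne_zero)) (inv_ne_zero ht0)) hrs.symm
  · rw [hrs, mul_comm t, inv_mul_cancel_right₀ ht0]

/-- **Finitely many norm classes of non-zero SKEW elements** (`σ` an isometric involution, (W-a) `hsq`, a uniformiser, finite residue field, `4 ≠ 0`, one non-zero skew `ξ₀`):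
there is a finite set `T` of non-zero skew elements with every non-zero skew `s` of the form `z·σz·t`, `t ∈ T`, `z ≠ 0` — the transvection parameters of `U(3)` modulo the
torus action [Rogawski1990 §3.9].  Units by `exists_finset_fixed_units_mod_norms`; valuations by powers of the fixed element `ϖ·σϖ` of value `exp(−2)` and (when it exists) ONE
fixed element of value `exp(−1)`. [cite: Serre1979, Ch. V §3 Cor. 2] [cite: Rogawski1990, §3.9 Prop. 3.9.1 p. 32] -/
theorem exists_finset_skew_mod_norms_of_involution (hσ : ∀ x : K, σ (σ x) = x) (hσv : ∀ x : K, Valued.v (σ x) = Valued.v x)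
    (hsq : ∀ s : K, Valued.v (s - 1) < Valued.v (4 : K) → ∃ r : K, r * r = s ∧ Valued.v (r - 1) < Valued.v (2 : K))
    {ϖ : K} (hϖ : Valued.v ϖ = WithZero.exp (-1 : ℤ)) [Finite 𝓀[K]] (h4 : (4 : K) ≠ 0) {ξ₀ : K} (hξ₀ : σ ξ₀ = -ξ₀) (hξ₀0 : ξ₀ ≠ 0) :
    ∃ T : Finset K, (∀ t ∈ T, σ t = -t ∧ t ≠ 0) ∧
      ∀ s : K, σ s = -s → s ≠ 0 → ∃ t ∈ T, ∃ z : K, z ≠ 0 ∧ s = z * σ z * t := by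
  classical
  obtain ⟨T, hT, hrep⟩ := exists_finset_fixed_units_mod_norms σ hσv hsq hϖ h4
  have hϖ0 : ϖ ≠ 0 := (Valuation.ne_zero_iff _).1 (by rw [hϖ]; exact WithZero.coe_ne_zero)
  -- the fixed element `N₀ = ϖ·σϖ` of value `exp(−2)`
  have hσN : σ (ϖ * σ ϖ) = ϖ * σ ϖ := by rw [map_mul, hσ, mul_comm]
  have hvN : Valued.v (ϖ * σ ϖ) = WithZero.exp (-2 : ℤ) := by rw [Valuation.map_mul, hσv, hϖ, ← WithZero.exp_add]; norm_num
  have hN0 : ϖ * σ ϖ ≠ 0 := mul_ne_zero hϖ0 ((map_ne_zero σ).2 hϖ0)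
  -- ONE fixed element of value `exp(−1)`, if any (else `1`)
  obtain ⟨f₁, hσf₁, hf₁0, hf₁⟩ : ∃ f₁ : K, σ f₁ = f₁ ∧ f₁ ≠ 0 ∧
      ((∃ f : K, σ f = f ∧ Valued.v f = WithZero.exp (-1 : ℤ)) → Valued.v f₁ = WithZero.exp (-1 : ℤ)) := by
    by_cases hodd : ∃ f : K, σ f = f ∧ Valued.v f = WithZero.exp (-1 : ℤ)
    · obtain ⟨f, hσf, hvf⟩ := hodd
      exact ⟨f, hσf, (Valuation.ne_zero_iff _).1 (by rw [hvf]; exact WithZero.coe_ne_zero), fun _ => hvf⟩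
    · exact ⟨1, map_one σ, one_ne_zero, fun h => absurd h hodd⟩
  refine ⟨T.image (fun t => ξ₀ * t) ∪ T.image (fun t => ξ₀ * (f₁ * t)), ?_, ?_⟩
  · intro t ht
    rcases Finset.mem_union.1 ht with ht | ht
    · obtain ⟨t', ht', rfl⟩ := Finset.mem_image.1 ht
      obtain ⟨hσt', hvt'⟩ := hT t' ht'
      exact ⟨by rw [map_mul, hξ₀, hσt', neg_mul], mul_ne_zero hξ₀0 ((Valuation.ne_zero_iff _).1 (by rw [hvt']; exact one_ne_zero))⟩
    · obtain ⟨t', ht', rfl⟩ := Finset.mem_image.1 ht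
      obtain ⟨hσt', hvt'⟩ := hT t' ht'
      exact ⟨by rw [map_mul, map_mul, hξ₀, hσf₁, hσt', neg_mul],
        mul_ne_zero hξ₀0 (mul_ne_zero hf₁0 ((Valuation.ne_zero_iff _).1 (by rw [hvt']; exact one_ne_zero)))⟩
  · intro s hσs hs0
    -- `g := s·ξ₀⁻¹` is fixed, non-zero, `v g = exp m`
    have hσg : σ (s * ξ₀⁻¹) = s * ξ₀⁻¹ := by rw [map_mul, map_inv₀, hσs, hξ₀, inv_neg, neg_mul_neg]
    have hg0 : s * ξ₀⁻¹ ≠ 0 := mul_ne_zero hs0 (inv_ne_zero hξ₀0)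
    obtain ⟨m, hm⟩ : ∃ m : ℤ, Valued.v (s * ξ₀⁻¹) = WithZero.exp m := by
      have h0 : Valued.v (s * ξ₀⁻¹) ≠ 0 := (Valuation.ne_zero_iff _).2 hg0
      obtain ⟨e, he⟩ := WithZero.ne_zero_iff_exists.1 h0
      exact ⟨Multiplicative.toAdd e, by rw [← he]; rfl⟩
    -- shift by a power of `N₀`: `g′ := g·N₀^j` has value `1` or `exp(−1)`
    obtain ⟨j, hj⟩ : ∃ j : ℤ, m - 2 * j = 0 ∨ m - 2 * j = -1 := ⟨(m + 1) / 2, by omega⟩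
    have hσg' : σ (s * ξ₀⁻¹ * (ϖ * σ ϖ) ^ j) = s * ξ₀⁻¹ * (ϖ * σ ϖ) ^ j := by rw [map_mul, map_zpow₀, hσg, hσN]
    have hvg' : Valued.v (s * ξ₀⁻¹ * (ϖ * σ ϖ) ^ j) = WithZero.exp (m - 2 * j) := by
      rw [Valuation.map_mul, map_zpow₀, hm, hvN, ← WithZero.exp_zsmul, ← WithZero.exp_add]; congr 1; ring
    -- the norm bookkeeping: `z·σz·N₀^{−j} = N(z·ϖ^{−j})`
    have hnorm : ∀ z : K, z * σ z * ((ϖ * σ ϖ) ^ j)⁻¹ = (z * ϖ ^ (-j)) * σ (z * ϖ ^ (-j)) := by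
      intro z
      rw [map_mul, map_zpow₀, mul_zpow, zpow_neg, zpow_neg, mul_inv]
      ring
    rcases hj with hj | hj
    · -- `v g′ = 1`: a fixed unit
      rw [hj, WithZero.exp_zero] at hvg'
      obtain ⟨t, htT, z, hz0, hgz⟩ := hrep _ hσg' hvg'
      refine ⟨ξ₀ * t, Finset.mem_union_left _ (Finset.mem_image_of_mem _ htT), z * ϖ ^ (-j), mul_ne_zero hz0 (zpow_ne_zero _ hϖ0), ?_⟩
      have hN0j : (ϖ * σ ϖ) ^ j ≠ 0 := zpow_ne_zero _ hN0
      rw [← hnorm]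
      calc s = (s * ξ₀⁻¹ * (ϖ * σ ϖ) ^ j) * ((ϖ * σ ϖ) ^ j)⁻¹ * ξ₀ := by field_simp
        _ = t * (z * σ z) * ((ϖ * σ ϖ) ^ j)⁻¹ * ξ₀ := by rw [hgz]
        _ = z * σ z * ((ϖ * σ ϖ) ^ j)⁻¹ * (ξ₀ * t) := by ring
    · -- `v g′ = exp(−1)`: divide by the chosen `f₁`
      rw [hj] at hvg'
      have hvf₁ : Valued.v f₁ = WithZero.exp (-1 : ℤ) := hf₁ ⟨_, hσg', hvg'⟩
      have hσg'' : σ (s * ξ₀⁻¹ * (ϖ * σ ϖ) ^ j * f₁⁻¹) = s * ξ₀⁻¹ * (ϖ * σ ϖ) ^ j * f₁⁻¹ := by rw [map_mul, map_inv₀, hσg', hσf₁]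
      have hvg'' : Valued.v (s * ξ₀⁻¹ * (ϖ * σ ϖ) ^ j * f₁⁻¹) = 1 := by
        rw [Valuation.map_mul, map_inv₀, hvg', hvf₁, mul_inv_cancel₀ WithZero.coe_ne_zero]
      obtain ⟨t, htT, z, hz0, hgz⟩ := hrep _ hσg'' hvg''
      refine ⟨ξ₀ * (f₁ * t), Finset.mem_union_right _ (Finset.mem_image_of_mem _ htT), z * ϖ ^ (-j), mul_ne_zero hz0 (zpow_ne_zero _ hϖ0), ?_⟩
      have hN0j : (ϖ * σ ϖ) ^ j ≠ 0 := zpow_ne_zero _ hN0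
      rw [← hnorm]
      calc s = (s * ξ₀⁻¹ * (ϖ * σ ϖ) ^ j * f₁⁻¹) * f₁ * ((ϖ * σ ϖ) ^ j)⁻¹ * ξ₀ := by field_simp
        _ = t * (z * σ z) * f₁ * ((ϖ * σ ϖ) ^ j)⁻¹ * ξ₀ := by rw [hgz]
        _ = z * σ z * ((ϖ * σ ϖ) ^ j)⁻¹ * (ξ₀ * (f₁ * t)) := by ring

end Generic

/-! ## §2 CM dress: the skew norm classes of `L_w ∕ L⁺_v` at a non-split place are finitely many -/

section CM

variable (L : Type) [Field L] [NumberField L] [IsCMField L] (v : HeightOneSpectrum (𝓞 ↥(maximalRealSubfield L)))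
  (w : Literature.NumberTheory.Automorphic.UnitaryGroup.PlacesOver L v) (hw : IsCMField.complexConj L • w.1 = w.1)

/-- **THE NON-ZERO `σ_w`-SKEW ELEMENTS OF `L_w` FALL INTO FINITELY MANY `N(L_w^×)`-CLASSES — at EVERY non-split place `w ∣ v` of the CM extension `L ∕ L⁺`, dyadic and wild
included** (transvection parameters of `U(Φ₃)(L⁺_v)` modulo conjugation, [Rogawski1990 §3.9]); hypothesis `hsq` = (W-a) «deep one-units of `L_w` are squares» BY STATEMENT
(LH5-p03 (g2)'s CM-free brick; drop it for the hypothesis-free twin once ★).  Proof: §1 at `K := L_w`, `σ := σ_w` (★ involution ∕ isometry), `ϖ := π_L`, `ξ₀ := x₀ − σ_w x₀`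
(★ `Liu2021.exists_galAdicCompletionMap_ne`), finite residue field ★ `finite_residueField_adicCompletion`, `4 ≠ 0` (`L_w ⊇ ℚ`).
[cite: Serre1979, Ch. V §2 Prop. 3, §3 Cor. 2] [cite: Rogawski1990, §3.9 Prop. 3.9.1 p. 32] -/
theorem exists_finset_skew_mod_norms
    (hsq : ∀ s : w.1.adicCompletion L, Valued.v (s - 1) < Valued.v (4 : w.1.adicCompletion L) →
      ∃ r : w.1.adicCompletion L, r * r = s ∧ Valued.v (r - 1) < Valued.v (2 : w.1.adicCompletion L)) :
    ∃ T : Finset (w.1.adicCompletion L),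
      (∀ t ∈ T, Literature.NumberTheory.Automorphic.galAdicCompletionMap (L := L) (IsCMField.complexConj L) hw t = -t ∧ t ≠ 0) ∧
      ∀ s : w.1.adicCompletion L, Literature.NumberTheory.Automorphic.galAdicCompletionMap (L := L) (IsCMField.complexConj L) hw s = -s → s ≠ 0 →
        ∃ t ∈ T, ∃ z : w.1.adicCompletion L, z ≠ 0 ∧
          s = z * Literature.NumberTheory.Automorphic.galAdicCompletionMap (L := L) (IsCMField.complexConj L) hw z * t := by
  haveI : Algebra.IsQuadraticExtension ↥(maximalRealSubfield L) L := IsCMField.isQuadraticExtension L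
  haveI : Finite 𝓀[w.1.adicCompletion L] := Literature.NumberTheory.Automorphic.finite_residueField_adicCompletion L w.1
  have hσ : ∀ y : w.1.adicCompletion L, Literature.NumberTheory.Automorphic.galAdicCompletionMap (L := L) (IsCMField.complexConj L) hw
      (Literature.NumberTheory.Automorphic.galAdicCompletionMap (L := L) (IsCMField.complexConj L) hw y) = y :=
    Literature.NumberTheory.Automorphic.UnitaryGroup.galAdicCompletionMap_galAdicCompletionMap_of_smul_eq (IsCMField.complexConj L) w (IsCMField.complexConj_ne_one L) hw
  have hσv : ∀ y : w.1.adicCompletion L, Valued.v (Literature.NumberTheory.Automorphic.galAdicCompletionMap (L := L) (IsCMField.complexConj L) hw y) = Valued.v y :=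
    fun y => Literature.NumberTheory.Automorphic.valued_galAdicCompletionMap (L := L) (IsCMField.complexConj L) hw y
  -- a uniformiser of `L_w`
  obtain ⟨πL, hπL⟩ := w.1.valuation_exists_uniformizer L
  have hz : Valued.v ((πL : L) : (w.1.adicCompletion L)) = WithZero.exp (-1 : ℤ) := by
    rw [HeightOneSpectrum.valuedAdicCompletion_eq_valuation', hπL]
  -- `4 ≠ 0` in `L_w ⊇ L ⊇ ℚ`
  have h4 : (4 : w.1.adicCompletion L) ≠ 0 := by
    rw [← map_ofNat (algebraMap L (w.1.adicCompletion L)) 4]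
    exact (map_ne_zero (algebraMap L (w.1.adicCompletion L))).2 (by norm_num)
  -- a non-zero skew `ξ₀ = x₀ − σ x₀`
  obtain ⟨x₀, hx₀⟩ := Literature.NumberTheory.Automorphic.Liu2021.exists_galAdicCompletionMap_ne _ L (IsCMField.complexConj L) (IsCMField.complexConj_ne_one L) hw
  have hξ : Literature.NumberTheory.Automorphic.galAdicCompletionMap (L := L) (IsCMField.complexConj L) hw
      (x₀ - Literature.NumberTheory.Automorphic.galAdicCompletionMap (L := L) (IsCMField.complexConj L) hw x₀) =
      -(x₀ - Literature.NumberTheory.Automorphic.galAdicCompletionMap (L := L) (IsCMField.complexConj L) hw x₀) := by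
    rw [map_sub, hσ, neg_sub]
  have hξ0 : x₀ - Literature.NumberTheory.Automorphic.galAdicCompletionMap (L := L) (IsCMField.complexConj L) hw x₀ ≠ 0 :=
    fun h => hx₀ (sub_eq_zero.1 h).symm
  exact exists_finset_skew_mod_norms_of_involution _ hσ hσv hsq hz h4 hξ hξ0

end CM

/-! ## §3 (ED. 2) The hypothesis-free twin: (W-a) is ★ -/

section CMAll

variable (L : Type) [Field L] [NumberField L] [IsCMField L] (v : HeightOneSpectrum (𝓞 ↥(maximalRealSubfield L)))
  (w : Literature.NumberTheory.Automorphic.UnitaryGroup.PlacesOver L v) (hw : IsCMField.complexConj L • w.1 = w.1)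

/-- = `exists_finset_skew_mod_norms` with the hypothesis `hsq` discharged by ★ p850199 `exists_mul_self_eq_of_valued_sub_one_lt_four_adicCompletion` (Hensel in `𝒪_w`):
**the non-zero `σ_w`-skew elements of `L_w` fall into FINITELY MANY `N(L_w^×)`-classes at EVERY non-split place — unconditionally.**
[cite: Serre1979, Ch. V §2 Prop. 3, §3 Cor. 2; Ch. II §3] [cite: Rogawski1990, §3.9 Prop. 3.9.1 p. 32] -/
theorem exists_finset_skew_mod_norms' :
    ∃ T : Finset (w.1.adicCompletion L),
      (∀ t ∈ T, Literature.NumberTheory.Automorphic.galAdicCompletionMap (L := L) (IsCMField.complexConj L) hw t = -t ∧ t ≠ 0) ∧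
      ∀ s : w.1.adicCompletion L, Literature.NumberTheory.Automorphic.galAdicCompletionMap (L := L) (IsCMField.complexConj L) hw s = -s → s ≠ 0 →
        ∃ t ∈ T, ∃ z : w.1.adicCompletion L, z ≠ 0 ∧
          s = z * Literature.NumberTheory.Automorphic.galAdicCompletionMap (L := L) (IsCMField.complexConj L) hw z * t :=
  exists_finset_skew_mod_norms L v w hw (exists_mul_self_eq_of_valued_sub_one_lt_four_adicCompletion L w.1)

end CMAll

end Literature.NumberTheory.LocalFields

end
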